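import Summits.CriticalPhenomena.PercolationContinuityZ3.Theorems.Transplant.FKConnectivityAllQHubCovPinning
import Summits.CriticalPhenomena.PercolationContinuityZ3.Theorems.SoloBlindKNUniformCoefficients
import HarnessLib

/-!
# Connectivity correlation inequalities for `φ_{w,q}`, every `q > 0` — the CLUSTER of a vertex: stochastic monotonicity in an
# adjacent edge (⇒ adjacent-edge negative correlation) and positive association (⇒ the hub inequality); conjecture nodes,
# the `q ≥ 1` cases, and the implications

Support file (`--supports stmt-CriticalPhenomena-4575`), FK sub-lane `prim-bschramm-fk-1` (gen 7) of the post-continuity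
programme; builds on p205010 (kernel theorem, internal audit signed; external expert review pending).  Definitions
(`clusterIn`, `ClusterDomAdjOn/FK`, `ClusterAssocOn/FK`, two `@[conjecture]` nodes — NOT asserted), no named facts, no sorries;
standard axioms.

FINDING OF THIS SEAT (exact rational computation, bschramm/FROM-fk-1-g7-CLUSTER-DOMINANCE.md).  For `0 < q < 1` the edges of
`φ_{w,q}` are (conjecturally) NEGATIVELY correlated, yet the CLUSTER `C_x` of a vertex behaves like a positively dependent,
monotone object with respect to the edges AT `x`:
* (MM, `ClusterDomAdjOn`) for an edge `f = xz` at `x`, the law of `C_x` given `f` open stochastically dominates the law of `C_x`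
  given `f` closed: `φ_{w[f↦0]}(C_x ∈ 𝒰) ≤ φ_{w[f↦1]}(C_x ∈ 𝒰)` for every up-set `𝒰` of vertex sets — verified on ALL up-sets
  (Dedekind families) for 600+ random weighted graphs on `≤ 6` vertices, `q ∈ {1/20,…,3}`: 0 violations; the same statement
  for an edge NOT at `x` FAILS in ≈ 75 % of instances (only the connection functionals `𝒰 = {S ∋ y}` survive there — that is EC⁺,
  equivalent to Grimmett's full negative-correlation conjecture);
* (CA, `ClusterAssocOn`) the law of `C_x` is positively associated: `φ(C_x ∈ 𝒰)·φ(C_x ∈ 𝒱) ≤ φ(C_x ∈ 𝒰 ∩ 𝒱)` for up-sets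
  `𝒰, 𝒱` — 0 violations in 216,090 pairs of up-sets (random weighted graphs, `≤ 5` vertices) and in the randomized `n ≤ 7` census.
MM with `𝒰 = {S ∋ y}` is EC⁺ at `(xz; x ↔ y)`, i.e. negative correlation of the ADJACENT pair `xy, xz`
(`edgeNegCorrAdjOn_of_clusterDomAdjOn`), so the node `ClusterDomAdjFKPos` implies `EdgeNegCorrAdjFKLtOne`/`HubCovBoundFKLtOne`;
CA with `𝒰 = {S ∋ o}`, `𝒱 = {S ∋ b}` is the hub inequality of Ayyer–Linusson–Ravichandran (`hubFK_of_clusterAssocFK`), so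
`ClusterAssocFKPos` implies `HubFKPos`.  Both hold for `q ≥ 1` (FKG / comparison in `𝐩`).  Neither is in print for `q < 1` as far
as searched; both are recorded `@[conjecture]`, NOT asserted.  The sufficient 'conditioned' form of MM
(`law(C_x ∪ C_z | x ↮ z) ⪰ law(C_x)`) and the FKG lattice condition for the law of `C_x` on the lattice of connected sets are
FALSE (memo §3), so proofs must use the random-cluster structure.
[cite: Grimmett2006, §3.9 eq. (3.94) (p. 63); Thm. (3.8) (p. 39); Thm. (3.21) (p. 43)]
[cite: AyyerLinussonRavichandran2025, §7 eq. (13), Conj. 7.1 (p. 22)] [cite: Wagner2006, Conj. 5.3 (p. 13)]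
-/

noncomputable section

namespace Summit.CriticalPhenomena.PercolationContinuityZ3.Theorems

namespace FK

open MeasureTheory Set Literature.Probability.LatticeModels Literature.Probability.Percolation
open scoped Classical

variable {V : Type*} [Fintype V]

/-! ### The cluster of a vertex as an event family -/

/-- The event "the open cluster of `x` belongs to the family `𝒰`". [cite: Grimmett2006, §1.3 (p. 10)] -/
def clusterIn (x : V) (𝒰 : Set (Set V)) : Set (BondConfig V) := {ω | openCluster ω x ∈ 𝒰}

omit [Fintype V] in
/-- For an up-set `𝒰` of vertex sets, `{C_x ∈ 𝒰}` is an increasing event. [folklore] -/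
theorem isUpperSet_clusterIn (x : V) {𝒰 : Set (Set V)} (h𝒰 : IsUpperSet 𝒰) : IsUpperSet (clusterIn x 𝒰) :=
  fun _ _ hle hω => h𝒰 (openCluster_mono hle x) hω

omit [Fintype V] in
/-- `{C_x ∋ y} = {x ↔ y}`. [folklore] -/
theorem clusterIn_mem_eq_openConn (x y : V) : clusterIn x {S | y ∈ S} = openConn x y := rfl

/-! ### MM — stochastic monotonicity of the cluster in an adjacent edge -/

/-- **Cluster dominance across an adjacent edge on the vertex type `V`** (MM): for every weight vector `w`, vertices `x, z` and every
up-set `𝒰` of vertex sets, `φ_{w[xz ↦ 0],q}(C_x ∈ 𝒰) ≤ φ_{w[xz ↦ 1],q}(C_x ∈ 𝒰)` — the law of the cluster of `x` given the edge `xz`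
open stochastically dominates its law given `xz` closed.  For `q ≥ 1` a theorem (`clusterDomAdjOn_of_one_le`); for `0 < q < 1` it
implies negative correlation of adjacent edges (`edgeNegCorrAdjOn_of_clusterDomAdjOn`) and is conjectural.
[cite: Grimmett2006, Thm. (3.21) (p. 43); §3.9 (p. 63)] -/
def ClusterDomAdjOn (V : Type*) [Fintype V] (q : ℝ) : Prop :=
  ∀ (w : Sym2 V → unitInterval) (x z : V) (𝒰 : Set (Set V)), IsUpperSet 𝒰 →
    (rcMeasureW (Function.update w s(x, z) 0) q ∅).real (clusterIn x 𝒰) ≤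
      (rcMeasureW (Function.update w s(x, z) 1) q ∅).real (clusterIn x 𝒰)

/-- **MM for `φ_{w,q}` on every finite weighted graph** (vertex types `Fin n`). [cite: Grimmett2006, Thm. (3.21) (p. 43); §3.9 (p. 63)] -/
def ClusterDomAdjFK (q : ℝ) : Prop := ∀ n : ℕ, ClusterDomAdjOn (Fin n) q

/-- **MM for every `q > 0`.**  CONJECTURE-SHAPED STATEMENT, NOT asserted.  Evidence (fk-1 g7, 2026-08-21, exact): all up-sets,
600+ random weighted graphs on `≤ 6` vertices × `q ∈ {1/20, 1/3, 2/3, 1, 3/2, 3}`, and a randomized census on `≤ 7` vertices with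
`q` down to `10⁻³`: 0 violations; the analogue for a NON-adjacent edge is false.  Implies `EdgeNegCorrAdjFKLtOne`
(`edgeNegCorrAdjFKLtOne_of_clusterDomAdjFKPos`). [cite: Grimmett2006, §3.9 (pp. 63–65)] [cite: Wagner2006, Conj. 5.3 (p. 13)] -/
@[conjecture] def ClusterDomAdjFKPos : Prop := ∀ q : ℝ, 0 < q → ClusterDomAdjFK q

/-- **MM holds for `q ≥ 1`** — the comparison inequality in `𝐩` (Grimmett 2006, Thm. (3.21)) for the increasing event `{C_x ∈ 𝒰}`.
[cite: Grimmett2006, Thm. (3.21) (p. 43)] -/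
theorem clusterDomAdjOn_of_one_le {q : ℝ} (hq : 1 ≤ q) : ClusterDomAdjOn V q := by
  intro w x z 𝒰 h𝒰
  refine rcMeasureW_real_mono_weights (fun e => ?_) hq ∅ (isUpperSet_clusterIn x h𝒰)
  by_cases he : e = s(x, z)
  · subst he; rw [Function.update_self, Function.update_self]; exact unitInterval.le_one _
  · rw [Function.update_of_ne he, Function.update_of_ne he]

/-- `ClusterDomAdjFK q` for `q ≥ 1`. [cite: Grimmett2006, Thm. (3.21) (p. 43)] -/
theorem clusterDomAdjFK_of_one_le {q : ℝ} (hq : 1 ≤ q) : ClusterDomAdjFK q := fun _ => clusterDomAdjOn_of_one_le hq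

/-- **MM ⇒ negative correlation of adjacent edges** (`0 < q ≤ 1`): apply MM in the state `w[xy ↦ 0]` to the up-set `{S ∋ y}` —
this is EC⁺ for `(xz; x ↔ y)`, and the master identity (`negCorr_of_edgeConnMono_at`) turns it into `φ(J_{xy} ∩ J_{xz}) ≤ φ(J_{xy})φ(J_{xz})`.
[cite: Grimmett2006, §3.9 eq. (3.94) (p. 63); Thm. (3.1)(a) (p. 37)] -/
theorem edgeNegCorrAdjOn_of_clusterDomAdjOn {q : ℝ} (hq0 : 0 < q) (hq1 : q ≤ 1) (h : ClusterDomAdjOn V q) :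
    EdgeNegCorrAdjOn V q := by
  intro w e f he hf hfe hv
  obtain ⟨v, hve, hvf⟩ := hv
  have he' : e = s(v, Sym2.Mem.other hve) := (Sym2.other_spec hve).symm
  have hf' : f = s(v, Sym2.Mem.other hvf) := (Sym2.other_spec hvf).symm
  set y := Sym2.Mem.other hve
  set z := Sym2.Mem.other hvf
  rw [he', hf']
  rw [he', hf'] at hfe
  refine negCorr_of_edgeConnMono_at hq0 hq1 w hfe ?_
  have key := h (Function.update w s(v, y) 0) v z {S | y ∈ S} (SoloBlindKN.isUpperSet_containing y)
  rwa [clusterIn_mem_eq_openConn] at key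

/-- **`ClusterDomAdjFK q → EdgeNegCorrAdjFK q`** (`0 < q ≤ 1`). [cite: Grimmett2006, §3.9 eq. (3.94) (p. 63)] -/
theorem edgeNegCorrAdjFK_of_clusterDomAdjFK {q : ℝ} (hq0 : 0 < q) (hq1 : q ≤ 1) (h : ClusterDomAdjFK q) :
    EdgeNegCorrAdjFK q := fun n => edgeNegCorrAdjOn_of_clusterDomAdjOn hq0 hq1 (h n)

/-- **Conjecture nodes: `ClusterDomAdjFKPos → EdgeNegCorrAdjFKLtOne`.** [cite: Grimmett2006, §3.9 (pp. 63–65)] [cite: Wagner2006, Conj. 5.3 (p. 13)] -/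
theorem edgeNegCorrAdjFKLtOne_of_clusterDomAdjFKPos (h : ClusterDomAdjFKPos) : EdgeNegCorrAdjFKLtOne :=
  fun q hq0 hq1 => edgeNegCorrAdjFK_of_clusterDomAdjFK hq0 hq1.le (h q hq0)

/-- **Conjecture nodes: `ClusterDomAdjFKPos → HubCovBoundFKLtOne`.** [cite: Grimmett2006, §3.9 (pp. 63–65)] -/
theorem hubCovBoundFKLtOne_of_clusterDomAdjFKPos (h : ClusterDomAdjFKPos) : HubCovBoundFKLtOne :=
  hubCovBoundFKLtOne_iff_edgeNegCorrAdjFKLtOne.2 (edgeNegCorrAdjFKLtOne_of_clusterDomAdjFKPos h)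

/-! ### CA — positive association of the cluster of a vertex -/

/-- **Positive association of the cluster of a vertex on the vertex type `V`** (CA): for every weight vector, vertex `x` and
up-sets `𝒰, 𝒱` of vertex sets, `φ(C_x ∈ 𝒰)·φ(C_x ∈ 𝒱) ≤ φ(C_x ∈ 𝒰 ∩ 𝒱)` (`φ = φ_{w,q}` a probability measure).  For `q ≥ 1` this is
FKG (Grimmett 2006, Thm. (3.8)); for `q < 1` conjectural; it contains the hub inequality (13) of Ayyer–Linusson–Ravichandran.
[cite: Grimmett2006, Thm. (3.8) (p. 39); §3.9 (p. 63)] [cite: AyyerLinussonRavichandran2025, §7 eq. (13) (p. 22)] -/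
def ClusterAssocOn (V : Type*) [Fintype V] (q : ℝ) : Prop :=
  ∀ (w : Sym2 V → unitInterval) (x : V) (𝒰 𝒱 : Set (Set V)), IsUpperSet 𝒰 → IsUpperSet 𝒱 →
    (rcMeasureW w q ∅).real (clusterIn x 𝒰) * (rcMeasureW w q ∅).real (clusterIn x 𝒱) ≤
      (rcMeasureW w q ∅).real (clusterIn x 𝒰 ∩ clusterIn x 𝒱)

/-- **CA for `φ_{w,q}` on every finite weighted graph** (vertex types `Fin n`). [cite: Grimmett2006, Thm. (3.8) (p. 39); §3.9 (p. 63)] -/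
def ClusterAssocFK (q : ℝ) : Prop := ∀ n : ℕ, ClusterAssocOn (Fin n) q

/-- **CA for every `q > 0`.**  CONJECTURE-SHAPED STATEMENT, NOT asserted.  Evidence (fk-1 g7, 2026-08-21, exact): 216,090 pairs of
up-sets over random weighted graphs on `≤ 5` vertices (`q ∈ {1/20,…,9/10}`) and a randomized census on `≤ 7` vertices: 0 violations;
the FKG lattice condition for the law of `C_x` (on the lattice of connected vertex sets) FAILS, also at `q = 1`, so CA is not a
lattice-condition consequence.  Implies `HubFKPos` (`hubFKPos_of_clusterAssocFKPos`).
[cite: AyyerLinussonRavichandran2025, §7 eq. (13), Conj. 7.1 (p. 22)] [cite: Grimmett2006, §3.9 (pp. 63–65)] -/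
@[conjecture] def ClusterAssocFKPos : Prop := ∀ q : ℝ, 0 < q → ClusterAssocFK q

/-- **CA holds for `q ≥ 1`** (FKG, Grimmett 2006 Thm. (3.8), for the increasing events `{C_x ∈ 𝒰}`, `{C_x ∈ 𝒱}`).
[cite: Grimmett2006, Thm. (3.8) (p. 39)] -/
theorem clusterAssocOn_of_one_le {q : ℝ} (hq : 1 ≤ q) : ClusterAssocOn V q :=
  fun w x _ _ h𝒰 h𝒱 => rcMeasureW_fkg (w := w) hq ∅ (isUpperSet_clusterIn x h𝒰) (isUpperSet_clusterIn x h𝒱)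

/-- `ClusterAssocFK q` for `q ≥ 1`. [cite: Grimmett2006, Thm. (3.8) (p. 39)] -/
theorem clusterAssocFK_of_one_le {q : ℝ} (hq : 1 ≤ q) : ClusterAssocFK q := fun _ => clusterAssocOn_of_one_le hq

/-- **CA ⇒ the hub inequality** `φ(o ↔ a)φ(b ↔ a) ≤ φ(o ↔ a ↔ b)` (Ayyer–Linusson–Ravichandran (13)): take the cluster of `a` and the
up-sets `{S ∋ o}`, `{S ∋ b}` (`0 < q`). [cite: AyyerLinussonRavichandran2025, §7 eq. (13) (p. 22)] -/
theorem hubUnder_of_clusterAssocOn {q : ℝ} (hq0 : 0 < q) (h : ClusterAssocOn V q) (w : Sym2 V → unitInterval) (o a b : V) :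
    HubUnder (rcMeasureW w q ∅) o a b := by
  haveI := isProbabilityMeasure_rcMeasureW w hq0 (∅ : Set V)
  unfold HubUnder
  rw [probReal_univ, one_mul]
  have key := h w a {S | o ∈ S} {S | b ∈ S} (SoloBlindKN.isUpperSet_containing o) (SoloBlindKN.isUpperSet_containing b)
  rw [clusterIn_mem_eq_openConn, clusterIn_mem_eq_openConn] at key
  have h1 : (openConn a o : Set (BondConfig V)) = openConn o a := by
    ext ω; exact ⟨fun h => SimpleGraph.Reachable.symm h, fun h => SimpleGraph.Reachable.symm h⟩
  have h2 : (openConn a b : Set (BondConfig V)) = openConn b a := by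
    ext ω; exact ⟨fun h => SimpleGraph.Reachable.symm h, fun h => SimpleGraph.Reachable.symm h⟩
  rwa [h1, h2] at key

/-- **`ClusterAssocFK q → HubFK q`** (`0 < q`). [cite: AyyerLinussonRavichandran2025, §7 eq. (13) (p. 22)] -/
theorem hubFK_of_clusterAssocFK {q : ℝ} (hq0 : 0 < q) (h : ClusterAssocFK q) : HubFK q :=
  fun n w o a b => hubUnder_of_clusterAssocOn hq0 (h n) w o a b

/-- **Conjecture nodes: `ClusterAssocFKPos → HubFKPos`.** [cite: AyyerLinussonRavichandran2025, §7 eq. (13), Conj. 7.1 (p. 22)] -/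
theorem hubFKPos_of_clusterAssocFKPos (h : ClusterAssocFKPos) : HubFKPos :=
  fun q hq0 => hubFK_of_clusterAssocFK hq0 (h q hq0)

end FK

end Summit.CriticalPhenomena.PercolationContinuityZ3.Theorems

end
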